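import Summits.QuantumFields.BalabanUV.T4Continuum.Support.NE7ApeTrivialFlatEndDischarged
import Summits.QuantumFields.BalabanUV.T4Continuum.Support.NE7TanCriticalGauge
import Summits.QuantumFields.BalabanUV.T4Continuum.Support.NE7TangentTransportGauge
import Summits.QuantumFields.BalabanUV.T4Continuum.Support.AveragingDeficitKDatum
import HarnessLib

/-!
# NE7ApeTrivialOrbitEnd — (APE) ON THE WHOLE GAUGE ORBIT OF THE TRIVIAL DATUM: the END of record (155) `smallField_of_trivialLetters_final` (fibre
# `cavgIter L (k+1) U = 1`) TRANSPORTED to every fibre `cavgIter L (k+1) U = 1^{v}`, `v` a unitary `N`-periodic coarse gauge — i.e. to EVERY flat datum of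
# trivial holonomy (= every pure gauge) — by the block-constant lift `w = (v ∘ (·∕M))⁻¹` (covariance of the average, of criticality and of the plaquette radii)

Cell `pub-balaban`, rung (B)+1 sub-cell t4, lineage `b2b-balaban-t4-ne7-p1`, generation 72 (CRUX PROVER NE7 #1, OWNER row NE7).  File G6 — memo H16 §8 class (a): the
data-class END restricted to flat data of TRIVIAL holonomy is bookkeeping over the trivial-datum END; this file does that bookkeeping.  Over (155)
`NE7ApeTrivialFlatEndDischarged` (t4-ne7-p2 gen 87, re-filed p393779), [tree] `NE3CpushGaugeCovariance.cavgIter_gaugeAct` (the `(k+1)`-fold average is gauge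
covariant: `cavgIter (U^u) = (cavgIter U)^{u∘(M•)}`), F39 `NE7TanCriticalGauge.tanCritical_gaugeAct`, `BlockAverageCurrent.smallField_gaugeAct`, F26
`smallField_of_gaugeAct_eq`, F52's corner-lift letters.
WHY.  F31's `hape` is asked on the DATA CLASS `𝒟_β`; the END of record covers ONE datum, `D = 1`.  The flat data of trivial holonomy are exactly the pure gauges
`D = 1^{v} = gaugeAct v 1`; for them no new analysis is needed: `U′ := U^{w}`, `w(x) = v(x∕M)⁻¹` (block constant), has `cavgIter (k+1) U′ = (1^{v})^{v⁻¹} = 1`, the same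
class and plaquette radii, and is tangent-critical iff `U` is; the trivial-datum END gives `SmallField U′ (…)`, and plaquettes are gauge invariant.  (Flat data with
NON-trivial commuting holonomies — the twisted torus — and curved references are NOT covered: memo H16 §8 (b), (c).)
WHAT ([folklore]; 0 def, 0 sorry; dimension `d + 1 ≥ 2`, `n : Type`).  **`smallField_of_trivialOrbit`**: (155) §3's `smallField_of_trivialLetters_final` with the fibre
constraint `cavgIter L (k+1) U = 1` REPLACED by `cavgIter L (k+1) U = gaugeAct v 1` (`v` unitary, `N`-periodic on the coarse lattice) and [B8] Theorem 2's output
`(u₀, A₀, a₀, a₁)` asked for the re-gauged configuration `U^{w}`; every other hypothesis, the constant `K` and the radius verbatim; conclusion `SmallField U (…)` for `U` itself.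
HONEST FRAMING (page 1): bookkeeping by name; [B8] Thm 2 (REP♭) NOT proved; the trivial-holonomy flat sector only (pure-gauge data), NOT F31's `hape` on `𝒟_β`; (APE) NOT
proved unconditionally; NOT ONE-STEP, NOT NE7; spine 0∕9; finite T⁴ rung (B)+1 — NOT infinite volume, NOT mass gap, NOT Clay.  Continuum YM on T⁴ ⇐ BetaPertH ∧ nine
spine estimates (0/9 proved); BetaPertH ⇐ (D1) ∧ (D4) ∧ CAP+tail; G-an2-4 gates asym, D1 and NE2/3/4.
-/

set_option autoImplicit false

open scoped BigOperators Matrix.Norms.L2Operator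
open NormedSpace Finset

namespace Summit.QuantumFields.BalabanUV.T4Continuum.NE7ApeTrivialOrbitEnd

open Literature.MathematicalPhysics.QuantumFieldTheory.Balaban1983to89
open B7Prop1Explicit B7Prop2Explicit MatrixLog UnitaryModel
open T4AveragingDeficitWall (IsUnitaryCfg IsSkewDir SmallField vary curlAt dirL1)
open T4AveragingDeficitWallBoundary (IsPeriodicCfg periodBox)
open AveragingDeficitPeriodicCounting (IsPeriodicDir)
open AveragingDeficitMultiLevelPrep (cavgIter LevelSmall)
open AveragingDeficitKDatum (isUnitaryCfg_gaugeAct gaugeAct_inv_gaugeAct)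
open MinimalActionLevels (perWin)
open BlockAveragePushDirSplit (flat)
open BlockAverageVaryHolo (nbRad)
open BlockAverageVaryDisc (rho0)
open BlockAverageCurrent (smallField_gaugeAct)
open B4Sect5Proof (latticeConst)
open B5Hk163Strip (kappa163)
open B5Hk163TorusHolderDecay (CdecD)
open NE3HessForm (hess dAction)
open NE3TangentCovariantTower (dirIter)
open NE3QbarIterCovLiftPrep (cruxC)
open NE3RightInverseSolveLetters (thetaLoc)
open NE3HatInvCurlLetters (curl1C)
open NE3EnergyShapes (IsUnitarySite)
open NE3CpushGaugeCovariance (cavgIter_gaugeAct)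
open NE7TanCriticalGauge (tanCritical_gaugeAct)
open NE7ConvOneStepWeightedUnique (smallField_of_gaugeAct_eq)
open NE7TangentTransportGauge (cornerLift_smul cornerLift_add_period)
open NE7EtaMinimiserGaugeCovariance (isUnitarySite_inv)
open NE7ApeTrivialFlatEndDischarged (smallField_of_trivialLetters_final)

noncomputable section

variable {d : ℕ}

/-- **(APE) ON THE GAUGE ORBIT OF THE TRIVIAL DATUM**: (155)'s `smallField_of_trivialLetters_final` for every fibre `cavgIter L (k+1) U = gaugeAct v 1` (`v` unitary
`N`-periodic), with [B8] Theorem 2's output asked for `U^{w}`, `w = (v ∘ (·∕L^{k+1}))⁻¹`; same `K`, same radius, conclusion for `U` itself. [folklore] -/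
theorem smallField_of_trivialOrbit {n : Type} [Fintype n] [DecidableEq n] [Nonempty n] (hd : 1 ≤ d) {L : ℕ} (hL : 2 ≤ L) :
    ∃ K : ℝ, 0 ≤ K ∧ ∀ (N : ℕ) [NeZero N] (k : ℕ)
    {U : Site (d + 1) → Fin (d + 1) → (Matrix n n ℂ)ˣ} (hU : IsUnitaryCfg U) {x δ : ℝ} (hx : 0 ≤ x) (hs : LevelSmall (d + 1) L k x)
    (hUx : SmallField U x) (hδ : 0 ≤ δ) (hUδ : SmallField U (δ / ((L : ℝ) ^ (k + 1)) ^ 2)) (hδx : δ / ((L : ℝ) ^ (k + 1)) ^ 2 ≤ x)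
    (hcritU : ∀ φ : Site (d + 1) → Fin (d + 1) → Matrix n n ℂ, IsSkewDir φ → IsPeriodicDir φ ((L ^ (k + 1) * N : ℕ) : ℤ) →
      dirIter L (k + 1) U φ = 0 → dAction U φ (perWin (d + 1) (L ^ (k + 1) * N)) = 0)
    {v : Site (d + 1) → (Matrix n n ℂ)ˣ} (hv : IsUnitarySite v) (hvP : ∀ (z : Site (d + 1)) (i : Fin (d + 1)), v (z + (N : ℤ) • e i) = v z)
    (hTopU : cavgIter L (k + 1) U = gaugeAct v (flat (d := d + 1) (n := n)))
    {u₀ : Site (d + 1) → (Matrix n n ℂ)ˣ} (hu₀ : IsUnitarySite u₀)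
    (hu₀P : ∀ (y : Site (d + 1)) (i : Fin (d + 1)), u₀ (y + (((L ^ (k + 1) * N : ℕ) : ℤ)) • e i) = u₀ y)
    {A₀ : Site (d + 1) → Fin (d + 1) → Matrix n n ℂ}
    (hgauge₀ : gaugeAct u₀ (gaugeAct (fun x : Site (d + 1) => (v (fun i => x i / ((L : ℤ) ^ (k + 1))))⁻¹) U) = vary (flat (d := d + 1) (n := n)) A₀ 1)
    (hA₀P : IsPeriodicDir A₀ ((L ^ (k + 1) * N : ℕ) : ℤ))
    {a₀ a₁ ω : ℝ} (ha₀ : ∀ (y : Site (d + 1)) (κ : Fin (d + 1)), ‖A₀ y κ‖ ≤ a₀)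
    (ha₁ : ∀ (y : Site (d + 1)) (κ τ : Fin (d + 1)), ‖A₀ (y + e τ) κ - A₀ y κ‖ ≤ a₁)
    (hω' : (L : ℝ) ^ (k + 1) * (Real.exp a₀ - 1)
        + 136 * ((((d + 1 : ℕ) : ℝ) + 1) * (((d + 1 : ℕ) : ℝ) + 4)) * (((L : ℝ) ^ (k + 1)) ^ 2 * (δ / ((L : ℝ) ^ (k + 1)) ^ 2)) ≤ ω)
    (hωd : 300 * ((d + 1 : ℕ) : ℝ) * ω ≤ 1) (hβ : Real.exp a₀ - 1 + 8 * ω / (L : ℝ) ^ (k + 1) ≤ 1 / 4)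
    {α₀ α₁ αh1 : ℝ} (hAα' : 2 * (Real.exp a₀ - 1 + 8 * ω / (L : ℝ) ^ (k + 1)) ≤ α₀)
    (hA1' : 4 / 3 * (Real.exp a₀ * a₁ + 2 * (8 * ω / (L : ℝ) ^ (k + 1)) * (Real.exp a₀ - 1)
        + 165 * ω / ((L : ℝ) ^ (k + 1)) ^ 2 + (8 * ω / (L : ℝ) ^ (k + 1)) ^ 2) ≤ α₁)
    (hα₁h : α₁ ≤ αh1 / ((L : ℝ) ^ (k + 1)) ^ 2)
    (hθ : cruxC (d + 1) L * (((L : ℝ) ^ (k + 1)) ^ 2 * x) < 1) (hθl : thetaLoc (d + 1) L * (((L : ℝ) ^ (k + 1)) ^ 2 * x) < 1)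
    (hε : ((L : ℝ) ^ (k + 1)) ^ 2 * x ≤ 1)
    (hσ : 4 * (3 + 12 * ((d + 1 : ℕ) : ℝ)) ^ 2 * (L : ℝ) ^ (k + 1) * α₀ ≤ rho0 (d + 1) L ^ 2)
    (hS1 : (8 * (3 + 12 * ((d + 1 : ℕ) : ℝ)) * (2 + 2 * ((((d + 1 : ℕ) : ℝ) + 1) * L)
        * (1 + ((1250 * ((nbRad (d + 1) L : ℝ) + L) + 8 * (((d + 1 : ℕ) : ℝ) * L) + 2 * L) * (((d + 1 : ℕ) : ℝ) * (2 * nbRad (d + 1) L + 1) ^ (d + 1)))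
            / ((L : ℝ) / (L : ℝ) ^ (d + 1))))) * ((L : ℝ) ^ (k + 1) * α₀) ≤ 1)
    (hb : 256 * (((d + 1 : ℕ) : ℝ) + 1) * L * (3 + 12 * ((d + 1 : ℕ) : ℝ)) * ((L : ℝ) ^ (k + 1) * α₀) ≤ 1),
    SmallField U
      ((K * (2 * (curl1C (d + 1) L / (1 - thetaLoc (d + 1) L * (((L : ℝ) ^ (k + 1)) ^ 2 * x)))
                * (8 * (3 + 12 * ((d + 1 : ℕ) : ℝ)) * (2 + 2 * ((((d + 1 : ℕ) : ℝ) + 1) * L)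
                  * (1 + ((1250 * ((nbRad (d + 1) L : ℝ) + L) + 8 * (((d + 1 : ℕ) : ℝ) * L) + 2 * L)
                      * (((d + 1 : ℕ) : ℝ) * (2 * nbRad (d + 1) L + 1) ^ (d + 1))) / ((L : ℝ) / (L : ℝ) ^ (d + 1)))))
                * δ * ((L : ℝ) ^ (k + 1) * α₀)
              + (Fintype.card (T4AveragingDeficitWall.Plane (d + 1)) : ℝ)
                * (144 * (((L : ℝ) ^ (k + 1) * α₀) * αh1) + 5440 * ((L : ℝ) ^ (k + 1) * α₀) ^ 3 + 8 * (αh1 * αh1)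
                    + 304 * (αh1 * ((L : ℝ) ^ (k + 1) * α₀) ^ 2) + 2688 * ((L : ℝ) ^ (k + 1) * α₀) ^ 4))
          + Fintype.card n * (2 * (CdecD d * (((d : ℝ) + 1) * (2 * ((d : ℝ) + 1))
              * ((2 + 32 / (kappa163 (d + 1) / (d + 1)) ^ 2) * latticeConst (d + 1) (kappa163 (d + 1) / (d + 1) / 2)))))
            * (0 + 28 * ((3 + 12 * ((d + 1 : ℕ) : ℝ)) * ((L : ℝ) ^ (k + 1) * α₀)
                  + 4 * (3 + 12 * ((d + 1 : ℕ) : ℝ)) ^ 3 / rho0 (d + 1) L ^ 2 * ((L : ℝ) ^ (k + 1) * α₀) ^ 2) ^ 2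
                + 4 * (4 * (3 + 12 * ((d + 1 : ℕ) : ℝ)) ^ 3 / rho0 (d + 1) L ^ 2 * ((L : ℝ) ^ (k + 1) * α₀) ^ 2))
          + 28 * ((L : ℝ) ^ (k + 1) * α₀) ^ 2)
        / ((L : ℝ) ^ (k + 1)) ^ 2) := by
  obtain ⟨K, hK, h⟩ := smallField_of_trivialLetters_final (n := n) hd hL
  refine ⟨K, hK, ?_⟩
  intro N _ k U hU x δ hx hs hUx hδ hUδ hδx hcritU v hv hvP hTopU u₀ hu₀ hu₀P A₀ hgauge₀ hA₀P a₀ a₁ ω ha₀ ha₁ hω' hωd hβ α₀ α₁ αh1 hAα' hA1'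
    hα₁h hθ hθl hε hσ hS1 hb
  have hL1 : 1 ≤ L := by omega
  have hm : ((L : ℤ) ^ (k + 1)) ≠ 0 := pow_ne_zero _ (by exact_mod_cast (show L ≠ 0 by omega))
  -- the block-constant lift of `v⁻¹`
  have hg : IsUnitarySite (fun z : Site (d + 1) => (v z)⁻¹) := isUnitarySite_inv hv
  have hw : IsUnitarySite (fun x : Site (d + 1) => (v (fun i => x i / ((L : ℤ) ^ (k + 1))))⁻¹) := fun x => hg _
  have hgP : ∀ (z : Site (d + 1)) (i : Fin (d + 1)), (fun z : Site (d + 1) => (v z)⁻¹) (z + (N : ℤ) • e i) = (fun z : Site (d + 1) => (v z)⁻¹) z :=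
    fun z i => by simp only [hvP z i]
  have hwP : ∀ (y : Site (d + 1)) (i : Fin (d + 1)),
      (fun x : Site (d + 1) => (v (fun i => x i / ((L : ℤ) ^ (k + 1))))⁻¹) (y + (((L ^ (k + 1) * N : ℕ) : ℤ)) • e i)
        = (fun x : Site (d + 1) => (v (fun i => x i / ((L : ℤ) ^ (k + 1))))⁻¹) y := fun y i => by
    have hc := cornerLift_add_period (fun z : Site (d + 1) => (v z)⁻¹) hm hgP y i
    push_cast
    exact hc
  -- the re-gauged configuration `U′ = U^{w}` and its letters
  have hU' : IsUnitaryCfg (gaugeAct (fun x : Site (d + 1) => (v (fun i => x i / ((L : ℤ) ^ (k + 1))))⁻¹) U) := isUnitaryCfg_gaugeAct hw hU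
  have hUx' := smallField_gaugeAct hw hUx
  have hUδ' := smallField_gaugeAct hw hUδ
  have hcrit' := tanCritical_gaugeAct hL1 k hU hx hs hUx hw hwP hcritU
  have hTop' : cavgIter L (k + 1) (gaugeAct (fun x : Site (d + 1) => (v (fun i => x i / ((L : ℤ) ^ (k + 1))))⁻¹) U) = flat := by
    rw [cavgIter_gaugeAct hL1 k hU hx hs hUx hw, hTopU]
    have hcorner : (fun w : Site (d + 1) => (fun x : Site (d + 1) => (v (fun i => x i / ((L : ℤ) ^ (k + 1))))⁻¹) (((L : ℤ) ^ (k + 1)) • w))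
        = fun z : Site (d + 1) => (v z)⁻¹ := funext fun w => cornerLift_smul (fun z : Site (d + 1) => (v z)⁻¹) hm w
    rw [hcorner, gaugeAct_inv_gaugeAct]
  have hfin := h N k hU' hx hs hUx' hδ hUδ' hδx hcrit' hTop' hu₀ hu₀P hgauge₀ hA₀P ha₀ ha₁ hω' hωd hβ hAα' hA1' hα₁h hθ hθl hε hσ hS1 hb
  exact smallField_of_gaugeAct_eq hw rfl hfin

end

end Summit.QuantumFields.BalabanUV.T4Continuum.NE7ApeTrivialOrbitEnd
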